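import Mathlib
import Summits.Ventures.HodgeRepro.Tier4.Common.AdelicDefs
import Summits.Ventures.HodgeRepro.Tier4.Line1.PlaneDefs
import Summits.Ventures.HodgeRepro.Tier4.Line1.RowBasis
import Summits.Ventures.HodgeRepro.Tier4.Line4.RationalLineScalars

/-!
# Tier4/Line4/RowLineCoords — `E′`-coordinates on a rational line in the ROW convention, and the trace form on a line

Blind re-derivation cell `pub-hodge-repro`, Tier 4 «PROVE THE STEP» (README §9–§10), LINE L4, cut C-L4-TAIL (S2′)(ii)
— the FIBRE BOUND (lead (R-27) S15050; TAKEN S15052), seat t4-L2-p3 (gen 4); module 2 (row coordinates).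

The ROW convention of `unitaryGroup W` (RowBasis): `E′` acts on rows by `v ↦ v ᵥ* Ω`, the lines are the row images
`{u ᵥ* Q}` of the `E′`-line projectors, the trace form is `β(u, v) = u ᵥ* B ⬝ᵥ v`.
* `linearIndependent_row_pair`: `z, zΩ` are independent for `z ≠ 0` (`row_eq_zero_of_smul_add_smul`);
  `row_range_le_span_pair`: the row image of an `Ω`-commuting rank-`2` projector is spanned by `z, zΩ` for any non-zero
  `z` in it (the row twin of ThreeLines' `range_le_span_pair`: `u ᵥ* Q = Qᵀ *ᵥ u`, `rank Qᵀ = rank Q`);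
* **`exists_row_coords`**: every `u` with `u ᵥ* Q = u` is `u = v ᵥ* escK x y` for the fixed non-zero `v` of the line —
  the `E′`-coordinate `x + yΩ` of `u` along `v`; `row_coords_unique`: it is unique;
* the scalar action on rows composes (`vecMul_escK_escK`), commutes with `Ω` (`vecMul_escK_Omega`);
* **the trace form on a line**: `β(v (x + yΩ), v (x′ + y′Ω)) = (x x′ + d y y′) β(v, v)` (`form_vecMul_escK`) — the real
  part of the hermitian product — and `β(u, u′) = 0` across two `B`-orthogonal lines (`form_eq_zero_of_ne`).

Mathlib + the landed modules only; no printed input; nothing here asserts anything about the truth of (P);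
HC_CM is NOT proved by anyone in this repository.
-/

set_option autoImplicit false

noncomputable section

namespace Summit.Ventures.HodgeRepro.Tier4.Line4

open Summit.Ventures.HodgeRepro.Tier4 Summit.Ventures.HodgeRepro.Tier4.Common
  Summit.Ventures.HodgeRepro.Tier4.Line1 Matrix

variable {k : Type} [Field k] (W : PlaneData k)

/-! ## 1. Coordinates on a row line -/

/-- `z, zΩ` are linearly independent for `z ≠ 0` -/
theorem linearIndependent_row_pair {d : k} (hΩ : W.Ω * W.Ω = -(d • (1 : Matrix (Fin 4) (Fin 4) k)))
    (hd : ¬ IsSquare (-d)) {z : Fin 4 → k} (hz : z ≠ 0) : LinearIndependent k ![z, z ᵥ* W.Ω] := by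
  rw [LinearIndependent.pair_iff]
  intro s t hst
  exact row_eq_zero_of_smul_add_smul W hΩ hd hz hst

/-- the row image of an `Ω`-commuting rank-`2` projector is spanned by `z, zΩ` for any non-zero `z` in it -/
theorem row_range_le_span_pair {d : k} (hΩ : W.Ω * W.Ω = -(d • (1 : Matrix (Fin 4) (Fin 4) k)))
    (hd : ¬ IsSquare (-d)) {Q : Matrix (Fin 4) (Fin 4) k} (hQ : Q * W.Ω = W.Ω * Q) (hr : Q.rank = 2)
    {z : Fin 4 → k} (hz : z ≠ 0) (hzQ : z ᵥ* Q = z) :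
    LinearMap.range Qᵀ.mulVecLin ≤ Submodule.span k {z, z ᵥ* W.Ω} := by
  have hzmem : z ∈ LinearMap.range Qᵀ.mulVecLin := ⟨z, by simp [hzQ]⟩
  have hle : Submodule.span k {z, z ᵥ* W.Ω} ≤ LinearMap.range Qᵀ.mulVecLin := by
    rw [Submodule.span_le]
    rintro v hv
    simp only [Set.mem_insert_iff, Set.mem_singleton_iff] at hv
    rcases hv with rfl | rfl
    · exact hzmem
    · refine ⟨z ᵥ* W.Ω, ?_⟩
      simp only [mulVecLin_apply, mulVec_transpose]
      rw [vecMul_vecMul, ← hQ, ← vecMul_vecMul, hzQ]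
  have hfin : Module.finrank k (Submodule.span k {z, z ᵥ* W.Ω}) = 2 := by
    have h := finrank_span_eq_card (R := k) (linearIndependent_row_pair W hΩ hd hz)
    have hr : Set.range ![z, z ᵥ* W.Ω] = {z, z ᵥ* W.Ω} := by
      ext v
      simp only [Set.mem_range, Set.mem_insert_iff, Set.mem_singleton_iff, Fin.exists_fin_two,
        Matrix.cons_val_zero, Matrix.cons_val_one]
      constructor
      · rintro (h | h) <;> [left; right] <;> exact h.symm
      · rintro (h | h) <;> [left; right] <;> exact h.symm
    rw [hr] at h
    simpa using h
  have hr' : Module.finrank k (LinearMap.range Qᵀ.mulVecLin) = 2 := by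
    have : Qᵀ.rank = 2 := by rw [rank_transpose, hr]
    exact this
  exact (Submodule.eq_of_le_of_finrank_eq hle (hfin.trans hr'.symm)).ge

/-- **coordinates on a row line**: every `u` with `u ᵥ* Q = u` is `v ᵥ* escK x y` for the fixed non-zero `v` of the
line (`v ᵥ* Q = v`). -/
theorem exists_row_coords {d : k} (hΩ : W.Ω * W.Ω = -(d • (1 : Matrix (Fin 4) (Fin 4) k)))
    (hd : ¬ IsSquare (-d)) {Q : Matrix (Fin 4) (Fin 4) k} (hQ : Q * W.Ω = W.Ω * Q) (hr : Q.rank = 2)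
    {v : Fin 4 → k} (hv : v ≠ 0) (hvQ : v ᵥ* Q = v) {u : Fin 4 → k} (hu : u ᵥ* Q = u) :
    ∃ x y : k, u = v ᵥ* escK W x y := by
  have hmem : u ∈ LinearMap.range Qᵀ.mulVecLin := ⟨u, by simp [hu]⟩
  have h := row_range_le_span_pair W hΩ hd hQ hr hv hvQ hmem
  obtain ⟨x, y, hxy⟩ := Submodule.mem_span_pair.1 h
  exact ⟨x, y, by rw [vecMul_escK, hxy]⟩

/-- the coordinates are unique -/
theorem row_coords_unique {d : k} (hΩ : W.Ω * W.Ω = -(d • (1 : Matrix (Fin 4) (Fin 4) k)))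
    (hd : ¬ IsSquare (-d)) {v : Fin 4 → k} (hv : v ≠ 0) {x y x' y' : k}
    (h : v ᵥ* escK W x y = v ᵥ* escK W x' y') : x = x' ∧ y = y' := by
  rw [vecMul_escK, vecMul_escK] at h
  have h0 : (x - x') • v + (y - y') • (v ᵥ* W.Ω) = 0 := by
    have := sub_eq_zero.2 h
    rw [← this]
    module
  obtain ⟨h1, h2⟩ := row_eq_zero_of_smul_add_smul W hΩ hd hv h0
  exact ⟨sub_eq_zero.1 h1, sub_eq_zero.1 h2⟩

/-- a non-zero scalar acts faithfully on a non-zero row -/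
theorem vecMul_escK_eq_zero_iff {d : k} (hΩ : W.Ω * W.Ω = -(d • (1 : Matrix (Fin 4) (Fin 4) k)))
    (hd : ¬ IsSquare (-d)) {v : Fin 4 → k} (hv : v ≠ 0) {x y : k} :
    v ᵥ* escK W x y = 0 ↔ x = 0 ∧ y = 0 := by
  constructor
  · intro h
    rw [vecMul_escK] at h
    exact row_eq_zero_of_smul_add_smul W hΩ hd hv h
  · rintro ⟨rfl, rfl⟩
    simp [vecMul_escK]

/-! ## 2. The scalar action on rows -/

/-- the scalar action composes -/
theorem vecMul_escK_escK {d : k} (hΩ : W.Ω * W.Ω = -(d • (1 : Matrix (Fin 4) (Fin 4) k))) (v : Fin 4 → k)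
    (x y x' y' : k) :
    (v ᵥ* escK W x y) ᵥ* escK W x' y' = v ᵥ* escK W (x * x' - d * (y * y')) (x * y' + y * x') := by
  rw [vecMul_vecMul, escK_mul_escK W hΩ]

/-- `(v (x + yΩ)) Ω = v ((−d y) + x Ω)` -/
theorem vecMul_escK_Omega {d : k} (hΩ : W.Ω * W.Ω = -(d • (1 : Matrix (Fin 4) (Fin 4) k))) (v : Fin 4 → k)
    (x y : k) : (v ᵥ* escK W x y) ᵥ* W.Ω = v ᵥ* escK W (-(d * y)) x := by
  have h : escK W x y * W.Ω = escK W (-(d * y)) x := by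
    have := escK_mul_escK W hΩ x y 0 1
    simp only [mul_zero, mul_one, zero_sub, add_zero] at this
    rw [← this]
    congr 1
    simp [escK]
  rw [vecMul_vecMul, h]

/-- the scalar action commutes with an `Ω`-commuting matrix -/
theorem vecMul_escK_comm (x y : k) {A : Matrix (Fin 4) (Fin 4) k} (hA : A * W.Ω = W.Ω * A) (v : Fin 4 → k) :
    (v ᵥ* escK W x y) ᵥ* A = (v ᵥ* A) ᵥ* escK W x y := by
  rw [vecMul_vecMul, vecMul_vecMul, escK_mul_comm W x y hA]

/-- the scalar action stays on the line -/
theorem vecMul_escK_vecMul_proj (x y : k) {Q : Matrix (Fin 4) (Fin 4) k} (hQ : Q * W.Ω = W.Ω * Q)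
    {v : Fin 4 → k} (hvQ : v ᵥ* Q = v) : (v ᵥ* escK W x y) ᵥ* Q = v ᵥ* escK W x y := by
  rw [vecMul_escK_comm W x y hQ, hvQ]

/-! ## 3. The trace form on a line -/

/-- `β(v, vΩ) = 0` (`β(uΩ, v) = −β(u, vΩ)` and the symmetry of `B`; characteristic `≠ 2`) -/
theorem form_self_Omega_eq_zero [CharZero k] (hΩB : W.Ω * W.B = -(W.B * W.Ωᵀ)) (v : Fin 4 → k) :
    v ᵥ* W.B ⬝ᵥ (v ᵥ* W.Ω) = 0 := by
  have h1 := form_vecMul_Omega_left W hΩB v v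
  -- symmetry: `(vΩ) B ⬝ v = v B ⬝ (vΩ)`
  have hsymm : (v ᵥ* W.Ω) ᵥ* W.B ⬝ᵥ v = v ᵥ* W.B ⬝ᵥ (v ᵥ* W.Ω) := by
    rw [dotProduct_comm, ← mulVec_transpose, dotProduct_mulVec, W.B_symm]
  rw [hsymm] at h1
  have h2 : (2 : k) * (v ᵥ* W.B ⬝ᵥ (v ᵥ* W.Ω)) = 0 := by linear_combination h1
  exact (mul_eq_zero.1 h2).resolve_left two_ne_zero

/-- `β(vΩ, v) = 0` -/
theorem form_Omega_self_eq_zero [CharZero k] (hΩB : W.Ω * W.B = -(W.B * W.Ωᵀ)) (v : Fin 4 → k) :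
    (v ᵥ* W.Ω) ᵥ* W.B ⬝ᵥ v = 0 := by
  rw [dotProduct_comm, ← mulVec_transpose, dotProduct_mulVec, W.B_symm]
  exact form_self_Omega_eq_zero W hΩB v

/-- **the trace form on a line**: `β(v (x + yΩ), v (x′ + y′Ω)) = (x x′ + d y y′) β(v, v)` -/
theorem form_vecMul_escK [CharZero k] {d : k} (hΩ : W.Ω * W.Ω = -(d • (1 : Matrix (Fin 4) (Fin 4) k)))
    (hΩB : W.Ω * W.B = -(W.B * W.Ωᵀ)) (v : Fin 4 → k) (x y x' y' : k) :
    (v ᵥ* escK W x y) ᵥ* W.B ⬝ᵥ (v ᵥ* escK W x' y') = (x * x' + d * (y * y')) * (v ᵥ* W.B ⬝ᵥ v) := by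
  have h0 := form_self_Omega_eq_zero W hΩB v
  have h0' : (v ᵥ* W.Ω) ᵥ* W.B ⬝ᵥ v = 0 := by
    rw [dotProduct_comm, ← mulVec_transpose, dotProduct_mulVec, W.B_symm]
    exact h0
  have h2 := form_vecMul_Omega_self W hΩ hΩB v
  rw [vecMul_escK, vecMul_escK]
  simp only [add_vecMul, smul_vecMul, add_dotProduct, dotProduct_add, smul_dotProduct, dotProduct_smul,
    smul_eq_mul, h0, h0', h2]
  ring

/-- rows of two `B`-orthogonal lines are `β`-orthogonal: `β(u Q, u′ Q′) = 0` when `Q B Q′ᵀ = 0` -/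
theorem form_eq_zero_of_proj_ne {Q Q' : Matrix (Fin 4) (Fin 4) k} (h : Q * W.B * Q'ᵀ = 0) (u u' : Fin 4 → k) :
    (u ᵥ* Q) ᵥ* W.B ⬝ᵥ (u' ᵥ* Q') = 0 := by
  rw [← mulVec_transpose Q' u', dotProduct_mulVec, vecMul_vecMul, vecMul_vecMul, ← Matrix.mul_assoc, h,
    vecMul_zero, zero_dotProduct]

/-- `Q_j B Q_{j′}ᵀ = Q_j Q_{j′} B` for `B`-self-adjoint projectors, hence `0` for `j ≠ j′` -/
theorem proj_mul_B_mul_transpose_eq_zero (Q : Fin 2 → Matrix (Fin 4) (Fin 4) k)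
    (hQB : ∀ j, Q j * W.B = W.B * (Q j)ᵀ) (hQi : ∀ j, Q j * Q j = Q j) (hQs : Q 0 + Q 1 = 1) {j j' : Fin 2}
    (hne : j ≠ j') : Q j * W.B * (Q j')ᵀ = 0 := by
  rw [Matrix.mul_assoc, ← hQB j', ← Matrix.mul_assoc, mul_eq_zero_of_ne Q hQi hQs hne, Matrix.zero_mul]

/-- the unitarity of a rational matrix on rows: `β(u g, u′ g) = β(u, u′)` -/
theorem form_vecMul_unitary {g : Matrix (Fin 4) (Fin 4) k} (hg : g * W.B * gᵀ = W.B) (u u' : Fin 4 → k) :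
    (u ᵥ* g) ᵥ* W.B ⬝ᵥ (u' ᵥ* g) = u ᵥ* W.B ⬝ᵥ u' := by
  rw [← mulVec_transpose g u', dotProduct_mulVec, vecMul_vecMul, vecMul_vecMul, ← Matrix.mul_assoc, hg]

end Summit.Ventures.HodgeRepro.Tier4.Line4

end
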